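import Literature.RingTheory.FormalGroups.LazardRing
import Mathlib.RingTheory.MvPolynomial.WeightedHomogeneous
import HarnessLib

/-!
# The weight grading of the Lazard ring: the Lazard relations are weighted homogeneous
# ([Lazard1955] §II (2.5)–(2.6) «isobares»; [Hazewinkel1978] §5.1)

Topic `Literature/RingTheory/FormalGroups`; namespace `Literature.RingTheory.FormalGroups`.  Two definitions (`lazardWeight`,
`IsIsobaric`) and fully proved theorems; no named fact, no instance, no notation, no `sorry`.

Give the generic coefficient `a_d` of `F_gen(X,Y) = X + Y + Σ a_d X^{d₀}Y^{d₁}` (file `LazardRing`) the WEIGHT `|d| − 1 ∈ ℤ`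
(Lazard: «a_d est de poids |d| − 1»; with `X, Y` of weight `1` the law is isobaric of weight `1`).  A series
`φ ∈ ℤ[a]⟦X₁,…,X_τ⟧` is **isobaric of weight `s`** (`IsIsobaric s φ`) when its coefficient of `X^e` is weighted homogeneous
of weight `|e| − s`.  Isobaric series are stable under sums and products (weights add), the variables are isobaric of weight
`1`, and — the point — substituting isobaric series of weight `1` into the generic series gives an isobaric series of weight
`1` (`isIsobaric_subst_genericLaw`).  Hence the associator `F_gen(F_gen(X,Y),Z) − F_gen(X,F_gen(Y,Z))` is isobaric of
weight `1`: **its coefficient of `XⁱYʲZᵏ` is weighted homogeneous of weight `i+j+k−1`**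
(`isWeightedHomogeneous_coeff_assocDiff_genericLaw`), so the Lazard ideal is generated by weighted homogeneous elements and
**every weighted homogeneous component of a Lazard relation is a Lazard relation**
(`weightedHomogeneousComponent_mem_lazardIdeal`, via Mathlib's homogeneous ideals of the weighted grading).

## References
* [Lazard1955] M. Lazard, *Sur les groupes de Lie formels à un paramètre*, Bull. SMF 83 (1955), §II (2.5)–(2.6), p. 256.
* [Hazewinkel1978] M. Hazewinkel, *Formal Groups and Applications* (1978), §5.1.
-/

noncomputable section

namespace Literature.RingTheory.FormalGroups

open _root_.MvPowerSeries (HasSubst subst coeff)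
open MvPolynomial (IsWeightedHomogeneous weightedHomogeneousComponent)

/-! ## §1 The weight and isobaric series -/

/-- **Lazard's weight** of the generic coefficient `a_d`: `|d| − 1 ∈ ℤ` (`|d| = d₀ + d₁`). [cite: Lazard1955, §II (2.5)] -/
def lazardWeight (d : Fin 2 →₀ ℕ) : ℤ := ((Finsupp.degree d : ℕ) : ℤ) - 1

/-- A `τ`-variable series over `ℤ[a]` is **isobaric of weight `s`** when its coefficient of `X^e` is weighted homogeneous
of weight `|e| − s` for Lazard's weight. [cite: Lazard1955, §II (2.6)] -/
def IsIsobaric {τ : Type*} (s : ℤ) (φ : MvPowerSeries τ LazardGen) : Prop :=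
  ∀ e : τ →₀ ℕ, IsWeightedHomogeneous lazardWeight (coeff e φ) (((Finsupp.degree e : ℕ) : ℤ) - s)

namespace IsIsobaric

variable {τ : Type*}

/-- `0` is isobaric of every weight. [cite: Lazard1955, §II (2.6)] -/
theorem zero (s : ℤ) : IsIsobaric s (0 : MvPowerSeries τ LazardGen) := fun e => by
  rw [MvPowerSeries.coeff_zero]; exact MvPolynomial.isWeightedHomogeneous_zero ℤ _ _

/-- Sums of isobaric series of the same weight are isobaric. [cite: Lazard1955, §II (2.6)] -/
theorem add {s : ℤ} {φ ψ : MvPowerSeries τ LazardGen} (hφ : IsIsobaric s φ) (hψ : IsIsobaric s ψ) :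
    IsIsobaric s (φ + ψ) := fun e => by
  rw [map_add]; exact (hφ e).add (hψ e)

/-- Negatives of isobaric series are isobaric. [cite: Lazard1955, §II (2.6)] -/
theorem neg {s : ℤ} {φ : MvPowerSeries τ LazardGen} (hφ : IsIsobaric s φ) : IsIsobaric s (-φ) := fun e => by
  rw [map_neg]; exact (MvPolynomial.weightedHomogeneousSubmodule ℤ lazardWeight _).neg_mem (hφ e)

/-- Differences of isobaric series of the same weight are isobaric. [cite: Lazard1955, §II (2.6)] -/
theorem sub {s : ℤ} {φ ψ : MvPowerSeries τ LazardGen} (hφ : IsIsobaric s φ) (hψ : IsIsobaric s ψ) :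
    IsIsobaric s (φ - ψ) := by
  rw [sub_eq_add_neg]; exact hφ.add hψ.neg

/-- Finite sums of isobaric series of the same weight are isobaric. [cite: Lazard1955, §II (2.6)] -/
theorem sum {ι : Type*} {s : ℤ} (S : Finset ι) {φ : ι → MvPowerSeries τ LazardGen}
    (h : ∀ i ∈ S, IsIsobaric s (φ i)) : IsIsobaric s (∑ i ∈ S, φ i) := by
  classical
  induction S using Finset.induction_on with
  | empty => rw [Finset.sum_empty]; exact zero s
  | insert a S ha ih =>
    rw [Finset.sum_insert ha]
    exact (h a (Finset.mem_insert_self a S)).add (ih fun i hi => h i (Finset.mem_insert_of_mem hi))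

/-- **Products of isobaric series are isobaric, weights adding.** [cite: Lazard1955, §II (2.6)] -/
theorem mul {s t : ℤ} {φ ψ : MvPowerSeries τ LazardGen} (hφ : IsIsobaric s φ) (hψ : IsIsobaric t ψ) :
    IsIsobaric (s + t) (φ * ψ) := fun e => by
  classical
  rw [MvPowerSeries.coeff_mul]
  refine IsWeightedHomogeneous.sum _ _ _ fun x hx => ?_
  have hsum : (x.1 : τ →₀ ℕ) + x.2 = e := Finset.mem_antidiagonal.mp hx
  have hw : (((Finsupp.degree x.1 : ℕ) : ℤ) - s) + (((Finsupp.degree x.2 : ℕ) : ℤ) - t) = ((Finsupp.degree e : ℕ) : ℤ) - (s + t) := by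
    rw [← hsum, map_add]; push_cast; ring
  rw [← hw]
  exact (hφ x.1).mul (hψ x.2)

/-- `1` is isobaric of weight `0`. [cite: Lazard1955, §II (2.6)] -/
theorem one : IsIsobaric 0 (1 : MvPowerSeries τ LazardGen) := fun e => by
  classical
  rw [MvPowerSeries.coeff_one]
  split_ifs with h
  · subst h; simpa using MvPolynomial.isWeightedHomogeneous_one ℤ lazardWeight
  · exact MvPolynomial.isWeightedHomogeneous_zero ℤ _ _

/-- Powers: `φ` isobaric of weight `s` ⟹ `φ^k` isobaric of weight `k s`. [cite: Lazard1955, §II (2.6)] -/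
theorem pow {s : ℤ} {φ : MvPowerSeries τ LazardGen} (hφ : IsIsobaric s φ) (k : ℕ) : IsIsobaric (k * s) (φ ^ k) := by
  induction k with
  | zero => simpa using one
  | succ k ih =>
    rw [pow_succ, Nat.cast_succ, add_mul, one_mul]
    exact ih.mul hφ

/-- The variables are isobaric of weight `1`. [cite: Lazard1955, §II (2.6)] -/
theorem X (i : τ) : IsIsobaric 1 (MvPowerSeries.X i : MvPowerSeries τ LazardGen) := fun e => by
  classical
  rw [MvPowerSeries.coeff_X]
  split_ifs with h
  · subst h; simpa [Finsupp.degree_single] using MvPolynomial.isWeightedHomogeneous_one ℤ lazardWeight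
  · exact MvPolynomial.isWeightedHomogeneous_zero ℤ _ _

/-- Scaling by a weighted homogeneous coefficient of weight `k` lowers the isobaric weight by `k`.
[cite: Lazard1955, §II (2.6)] -/
theorem smul {s k : ℤ} {c : LazardGen} (hc : IsWeightedHomogeneous lazardWeight c k) {φ : MvPowerSeries τ LazardGen}
    (hφ : IsIsobaric s φ) : IsIsobaric (s - k) (c • φ) := fun e => by
  rw [map_smul, smul_eq_mul, show ((Finsupp.degree e : ℕ) : ℤ) - (s - k) = k + (((Finsupp.degree e : ℕ) : ℤ) - s) by ring]
  exact hc.mul (hφ e)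

end IsIsobaric

/-! ## §2 The generic series and its associator are isobaric -/

/-- **The generic coefficients are weighted homogeneous**: `coeff_d F_gen` has weight `|d| − 1` (it is `a_d`, `1` or `0`).
[cite: Lazard1955, §II (2.5)] -/
theorem isWeightedHomogeneous_coeff_genericLaw (d : Fin 2 →₀ ℕ) :
    IsWeightedHomogeneous lazardWeight (coeff d genericLaw) (((Finsupp.degree d : ℕ) : ℤ) - 1) := by
  rw [coeff_genericLaw]
  split_ifs with h1 h2
  · exact MvPolynomial.isWeightedHomogeneous_X ℤ lazardWeight d
  · have hd : ((Finsupp.degree d : ℕ) : ℤ) - 1 = 0 := by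
      rcases h2 with rfl | rfl <;> simp [Finsupp.degree_single]
    rw [hd]; exact MvPolynomial.isWeightedHomogeneous_one ℤ lazardWeight
  · exact MvPolynomial.isWeightedHomogeneous_zero ℤ _ _

/-- A `Fin 2`-indexed `Finsupp.prod` of powers is the product of the two powers (plumbing).
[cite: BourbakiAlgebraII2003, Ch. IV §5 no. 1] -/
private theorem prod_pow_fin_two' {τ : Type*} (d : Fin 2 →₀ ℕ) (a : Fin 2 → MvPowerSeries τ LazardGen) :
    d.prod (fun s e => a s ^ e) = a 0 ^ d 0 * a 1 ^ d 1 := by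
  rw [Finsupp.prod_fintype _ _ (fun i => pow_zero _)]
  exact Fin.prod_univ_two _

/-- **Substitution preserves isobaric weight one**: for substitutable `a₀, a₁` isobaric of weight `1`, the series
`F_gen(a₀, a₁)` is isobaric of weight `1`. [cite: Lazard1955, §II (2.6)] -/
theorem isIsobaric_subst_genericLaw {τ : Type*} {a : Fin 2 → MvPowerSeries τ LazardGen} (ha : HasSubst a)
    (h0 : IsIsobaric 1 (a 0)) (h1 : IsIsobaric 1 (a 1)) : IsIsobaric 1 (genericLaw.subst a) := by
  classical
  intro e
  rw [MvPowerSeries.coeff_subst ha, finsum_eq_sum _ (MvPowerSeries.coeff_subst_finite ha genericLaw e)]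
  refine IsWeightedHomogeneous.sum _ _ _ fun d _ => ?_
  rw [prod_pow_fin_two']
  have hprod : IsIsobaric ((d 0 : ℤ) * 1 + (d 1 : ℤ) * 1) (a 0 ^ d 0 * a 1 ^ d 1) := (h0.pow (d 0)).mul (h1.pow (d 1))
  have hdeg : (d 0 : ℤ) * 1 + (d 1 : ℤ) * 1 = ((Finsupp.degree d : ℕ) : ℤ) := by
    rw [Finsupp.degree_eq_sum, Fin.sum_univ_two]; push_cast; ring
  rw [hdeg] at hprod
  have h := (hprod.smul (isWeightedHomogeneous_coeff_genericLaw d)) e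
  rw [show ((Finsupp.degree d : ℕ) : ℤ) - (((Finsupp.degree d : ℕ) : ℤ) - 1) = 1 by ring] at h
  exact h

/-- `F_gen(Xᵢ, Xⱼ)` is substitutable (plumbing). [cite: BourbakiAlgebraII2003, Ch. IV §5 no. 1] -/
private theorem isIsobaric_subst_genericLaw_X_X {τ : Type*} (i j : τ) :
    IsIsobaric 1 (genericLaw.subst ![(MvPowerSeries.X i : MvPowerSeries τ LazardGen), MvPowerSeries.X j]) :=
  isIsobaric_subst_genericLaw HasSubst.X_X (IsIsobaric.X i) (IsIsobaric.X j)

/-- **The associator of the generic series is isobaric of weight one.** [cite: Lazard1955, §II (2.6)] -/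
theorem isIsobaric_assocDiff_genericLaw : IsIsobaric 1 (assocDiff genericLaw) := by
  unfold assocDiff
  refine IsIsobaric.sub ?_ ?_
  · exact isIsobaric_subst_genericLaw (HasSubst.cons_subst_zero_left (0 : Fin 3) 1 2 constantCoeff_genericLaw)
      (isIsobaric_subst_genericLaw_X_X 0 1) (IsIsobaric.X 2)
  · exact isIsobaric_subst_genericLaw (HasSubst.cons_subst_zero_right (0 : Fin 3) 1 2 constantCoeff_genericLaw)
      (IsIsobaric.X 0) (isIsobaric_subst_genericLaw_X_X 1 2)

/-- **The associator coefficients are weighted homogeneous**: the coefficient of `XⁱYʲZᵏ` in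
`F_gen(F_gen(X,Y),Z) − F_gen(X,F_gen(Y,Z))` has weight `i + j + k − 1`. [cite: Lazard1955, §II (2.6)] -/
theorem isWeightedHomogeneous_coeff_assocDiff_genericLaw (n : Fin 3 →₀ ℕ) :
    IsWeightedHomogeneous lazardWeight (coeff n (assocDiff genericLaw)) (((Finsupp.degree n : ℕ) : ℤ) - 1) :=
  isIsobaric_assocDiff_genericLaw n

/-! ## §3 The Lazard ideal is homogeneous for the weight grading -/

/-- `swapIdx` preserves the degree (plumbing). [cite: Lazard1955, §II (2.5)] -/
theorem degree_swapIdx (d : Fin 2 →₀ ℕ) : Finsupp.degree (swapIdx d) = Finsupp.degree d := by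
  rw [Finsupp.degree_eq_sum, Finsupp.degree_eq_sum, Fin.sum_univ_two, Fin.sum_univ_two, swapIdx_apply_zero,
    swapIdx_apply_one, add_comm]

/-- **Every Lazard relation is weighted homogeneous.** [cite: Lazard1955, §II (2.6)] -/
theorem exists_isWeightedHomogeneous_of_mem_lazardRelations {x : LazardGen} (hx : x ∈ lazardRelations) :
    ∃ k : ℤ, IsWeightedHomogeneous lazardWeight x k := by
  rcases hx with ⟨d, _, rfl⟩ | ⟨d, rfl⟩ | ⟨n, rfl⟩
  · exact ⟨_, MvPolynomial.isWeightedHomogeneous_X ℤ lazardWeight d⟩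
  · refine ⟨lazardWeight d, (MvPolynomial.weightedHomogeneousSubmodule ℤ lazardWeight (lazardWeight d)).sub_mem
      (MvPolynomial.isWeightedHomogeneous_X ℤ lazardWeight d) ?_⟩
    have h := MvPolynomial.isWeightedHomogeneous_X ℤ lazardWeight (swapIdx d)
    have hw : lazardWeight (swapIdx d) = lazardWeight d := by rw [lazardWeight, lazardWeight, degree_swapIdx]
    rw [hw] at h
    exact h
  · exact ⟨_, isWeightedHomogeneous_coeff_assocDiff_genericLaw n⟩

/-- **Weighted homogeneous components of Lazard relations are Lazard relations** (the Lazard ideal is homogeneous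
for the weight grading of `ℤ[a]`). [cite: Lazard1955, §II (2.6)] -/
theorem weightedHomogeneousComponent_mem_lazardIdeal {r : LazardGen} (hr : r ∈ lazardIdeal) (k : ℤ) :
    weightedHomogeneousComponent lazardWeight k r ∈ lazardIdeal := by
  classical
  letI := MvPolynomial.weightedGradedAlgebra ℤ lazardWeight
  have hI : lazardIdeal.IsHomogeneous (MvPolynomial.weightedHomogeneousSubmodule ℤ lazardWeight) :=
    Ideal.homogeneous_span _ _ fun x hx => exists_isWeightedHomogeneous_of_mem_lazardRelations hx
  exact MvPolynomial.weightedHomogeneousComponent_mem_of_mem ℤ lazardWeight hI hr k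

end Literature.RingTheory.FormalGroups
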